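import Summits.QuantumFields.QCD.Theses.NestedDissectionSea
import Summits.QuantumFields.QCD.Theorems.NestedDissectionSeaEarlyCrosserLawPinWindowCrossing

/-!
# The torus quasimode event of line `cells-inherit-torus-extinction` is closed (hence Borel)
(crux `Summit.QuantumFields.QCD.Theses.NestedDissectionSea.EarlyCrosserLaw`, item
stmt-QuantumFields-13995; registered stubs `isClosed_torusQuasimodeEvent`,
`measurableSet_torusQuasimodeEvent` of the line's open physics stub S2′
`stub_torusLocalExtinctionOnBranch`)

For a window box `(x, s)` of the four-torus of side `N`, a compact bare-mass interval `[lo, hi]` and a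
level `η`, the CHARGED EVENT of S2′ (one flavour, one threshold interval)

  `E = {U | ∃ μ' ∈ [lo, hi], ∃ v ≠ 0 supported in the box, ‖D_W(U, μ', 1) v̂‖₂² ≤ η² ‖v‖₂²}`

(`v̂ = fun q => if h : wilsonBox x s q then v ⟨q, h⟩ else 0` the zero-extension of `v` to the torus,
`D_W` the torus Wilson–Dirac operator in the fundamental representation) is CLOSED in the
configuration space `GaugeConfig 4 N SU3 = (Edge 4 N → SU(3))`, hence Borel measurable — so S2′ can
be stated as a plain phase-quenched probability instead of through a majorant.

Proof (compactness).  The quasimode inequality is homogeneous in `v`, so `E` is the first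
projection of the LIFTED set

  `K = {(U, μ', v) | lo ≤ μ' ≤ hi, ‖v‖ = 1, ‖D_W(U, μ', 1) v̂‖₂² ≤ η² ‖v‖₂²}`

(normalise `v ↦ ‖v‖⁻¹ • v`, sup norm; `fst_image_torusQuasimodeLift`).  `K` is closed:
`(U, μ') ↦ D_W(U, μ', 1) = D_W(U, 0, 1) + μ'·1` is JOINTLY continuous
(`PinnedLine.wilsonDirac_mass_eq_add_smul`, `continuous_wilsonDirac`;
`continuous_wilsonDirac_jointMass`), the zero-extension is continuous (`continuous_boxZeroExt`),
so both sides of the inequality are continuous in `(U, μ', v)` (`Continuous.matrix_mulVec`, finite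
sums of squared norms).  `K` lies in the compact `univ ×ˢ ([lo, hi] ×ˢ closedBall 0 1)` (the
configuration space is compact, the box vectors form a finite-dimensional = proper normed space),
so `K` is compact (`isCompact_torusQuasimodeLift`), its continuous image `E` is compact, hence
closed in the Hausdorff configuration space (`isClosed_torusQuasimodeEvent`) and Borel
(`measurableSet_torusQuasimodeEvent`).
-/

noncomputable section

open scoped BigOperators
open Matrix Complex Filter MeasureTheory
open Literature.MathematicalPhysics.QuantumLattice Literature.MathematicalPhysics.QuantumFieldTheory
  Literature.Probability.LatticeModels
open Summit.QuantumFields.QCD.Theses.NestedDissectionSea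

namespace Summit.QuantumFields.QCD.Cruxes.EarlyCrosserLaw.CellsInheritTorusExtinction

/-! ## The zero-extension of box vectors: continuity and homogeneity -/

/-- The zero-extension `v ↦ v̂ = fun q => if h : wilsonBox x s q then v ⟨q, h⟩ else 0` of box vectors
to torus vectors is continuous (each coordinate is a coordinate of `v` or `0`). -/
theorem continuous_boxZeroExt {N : ℕ} (x : TorusSite 4 N) (s : Fin 4 → ℕ) :
    Continuous fun v : {p // wilsonBox x s p} → ℂ =>
      (fun q => if h : wilsonBox x s q then v ⟨q, h⟩ else 0 : TorusSite 4 N × Fin 3 × Fin 4 → ℂ) := by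
  refine continuous_pi fun q => ?_
  by_cases h : wilsonBox x s q
  · simp only [dif_pos h]
    exact continuous_apply _
  · simp only [dif_neg h]
    exact continuous_const

/-- Homogeneity of `v ↦ D v̂` under real scalars: `D (t • v)̂ = t • D v̂`. -/
theorem mulVec_boxZeroExt_smul {N : ℕ} [NeZero N] (x : TorusSite 4 N) (s : Fin 4 → ℕ)
    (D : Matrix (TorusSite 4 N × Fin 3 × Fin 4) (TorusSite 4 N × Fin 3 × Fin 4) ℂ) (t : ℝ)
    (v : {p // wilsonBox x s p} → ℂ) :
    (D *ᵥ fun q => if h : wilsonBox x s q then (t • v) ⟨q, h⟩ else 0) =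
      t • (D *ᵥ fun q => if h : wilsonBox x s q then v ⟨q, h⟩ else 0) := by
  rw [← mulVec_smul]
  congr 1
  funext q
  by_cases h : wilsonBox x s q
  · simp only [dif_pos h, Pi.smul_apply]
  · simp only [dif_neg h, Pi.smul_apply, smul_zero]

/-- `Σ_i ‖(t • w) i‖² = t² Σ_i ‖w i‖²` for a real scalar `t`. -/
theorem sum_norm_sq_smul {ι : Type*} [Fintype ι] (t : ℝ) (w : ι → ℂ) :
    ∑ i, ‖(t • w) i‖ ^ 2 = t ^ 2 * ∑ i, ‖w i‖ ^ 2 := by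
  rw [Finset.mul_sum]
  refine Finset.sum_congr rfl fun i _ => ?_
  rw [Pi.smul_apply, norm_smul, mul_pow, Real.norm_eq_abs, sq_abs]

/-! ## Joint continuity of the torus Wilson–Dirac matrix in (gauge field, bare mass) -/

/-- `(U, μ') ↦ D_W(U, μ', 1)` is JOINTLY continuous: the bare mass enters additively,
`D_W(U, μ', 1) = D_W(U, 0, 1) + μ'·1` (`PinnedLine.wilsonDirac_mass_eq_add_smul`), and
`U ↦ D_W(U, 0, 1)` is continuous (`continuous_wilsonDirac`). -/
theorem continuous_wilsonDirac_jointMass {N : ℕ} :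
    Continuous fun z : GaugeConfig 4 N SU3 × ℝ => wilsonDirac (fundamentalRep (Fin 3)) z.1 z.2 1 := by
  have h : (fun z : GaugeConfig 4 N SU3 × ℝ => wilsonDirac (fundamentalRep (Fin 3)) z.1 z.2 1) =
      fun z => wilsonDirac (fundamentalRep (Fin 3)) z.1 0 1 + ((z.2 : ℝ) : ℂ) • (1 : Matrix _ _ ℂ) := by
    funext z
    exact PinnedLine.wilsonDirac_mass_eq_add_smul z.1 z.2 1
  rw [h]
  exact ((continuous_wilsonDirac (fundamentalRep (Fin 3)) (continuous_fundamentalRep (Fin 3))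
    0 1).comp continuous_fst).add
    ((Complex.continuous_ofReal.comp continuous_snd).smul continuous_const)

/-! ## The lifted (normalised) quasimode set and its projection -/

/-- **The lifted quasimode set is compact.**
`K = {(U, μ', v) | lo ≤ μ' ≤ hi, ‖v‖ = 1, ‖D_W(U, μ', 1) v̂‖₂² ≤ η² ‖v‖₂²}` (sup norm on box vectors) is
closed — four closed conditions on continuous functions of `(U, μ', v)` (joint continuity of `D_W` in
`(U, μ')`, `Continuous.matrix_mulVec`, finite sums of squared norms) — and contained in the compact
`univ ×ˢ ([lo, hi] ×ˢ closedBall 0 1)` (compact configuration space; `[lo, hi]` compact; the closed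
unit ball of the finite-dimensional space of box vectors is compact, `ProperSpace`). -/
theorem isCompact_torusQuasimodeLift {N : ℕ} [NeZero N] (x : TorusSite 4 N) (s : Fin 4 → ℕ)
    (lo hi η : ℝ) :
    IsCompact {z : GaugeConfig 4 N SU3 × ℝ × ({p // wilsonBox x s p} → ℂ) |
      lo ≤ z.2.1 ∧ z.2.1 ≤ hi ∧ ‖z.2.2‖ = 1 ∧
        ∑ p, ‖(wilsonDirac (fundamentalRep (Fin 3)) z.1 z.2.1 1 *ᵥ
            fun q => if h : wilsonBox x s q then z.2.2 ⟨q, h⟩ else 0) p‖ ^ 2 ≤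
          η ^ 2 * ∑ q, ‖z.2.2 q‖ ^ 2} := by
  have hμ : Continuous fun z : GaugeConfig 4 N SU3 × ℝ × ({p // wilsonBox x s p} → ℂ) => z.2.1 :=
    continuous_fst.comp continuous_snd
  have hv : Continuous fun z : GaugeConfig 4 N SU3 × ℝ × ({p // wilsonBox x s p} → ℂ) => z.2.2 :=
    continuous_snd.comp continuous_snd
  have hD : Continuous fun z : GaugeConfig 4 N SU3 × ℝ × ({p // wilsonBox x s p} → ℂ) =>
      wilsonDirac (fundamentalRep (Fin 3)) z.1 z.2.1 1 :=
    (continuous_wilsonDirac_jointMass (N := N)).comp (continuous_fst.prodMk hμ)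
  have hmv : Continuous fun z : GaugeConfig 4 N SU3 × ℝ × ({p // wilsonBox x s p} → ℂ) =>
      wilsonDirac (fundamentalRep (Fin 3)) z.1 z.2.1 1 *ᵥ
        fun q => if h : wilsonBox x s q then z.2.2 ⟨q, h⟩ else 0 :=
    hD.matrix_mulVec ((continuous_boxZeroExt x s).comp hv)
  have hL : Continuous fun z : GaugeConfig 4 N SU3 × ℝ × ({p // wilsonBox x s p} → ℂ) =>
      ∑ p, ‖(wilsonDirac (fundamentalRep (Fin 3)) z.1 z.2.1 1 *ᵥ
        fun q => if h : wilsonBox x s q then z.2.2 ⟨q, h⟩ else 0) p‖ ^ 2 :=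
    continuous_finsetSum _ fun p _ => ((continuous_apply p).comp hmv).norm.pow 2
  have hR : Continuous fun z : GaugeConfig 4 N SU3 × ℝ × ({p // wilsonBox x s p} → ℂ) =>
      η ^ 2 * ∑ q, ‖z.2.2 q‖ ^ 2 :=
    continuous_const.mul
      (continuous_finsetSum _ fun q _ => ((continuous_apply q).comp hv).norm.pow 2)
  refine (isCompact_univ.prod (isCompact_Icc.prod
    (isCompact_closedBall (0 : {p // wilsonBox x s p} → ℂ) 1))).of_isClosed_subset ?_
    fun _ hz => ⟨Set.mem_univ _, ⟨hz.1, hz.2.1⟩, mem_closedBall_zero_iff.2 hz.2.2.1.le⟩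
  simp only [Set.setOf_and]
  exact (isClosed_le continuous_const hμ).inter ((isClosed_le hμ continuous_const).inter
    ((isClosed_eq hv.norm continuous_const).inter (isClosed_le hL hR)))

/-- **The charged event is the first projection of the lifted set**: a witness `(μ', v ≠ 0)` is
normalised to `‖v‖⁻¹ • v` (both sides of the quasimode inequality scale by `‖v‖⁻²`,
`mulVec_boxZeroExt_smul`, `sum_norm_sq_smul`); conversely `‖v‖ = 1 ⇒ v ≠ 0`. -/
theorem fst_image_torusQuasimodeLift {N : ℕ} [NeZero N] (x : TorusSite 4 N) (s : Fin 4 → ℕ)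
    (lo hi η : ℝ) :
    Prod.fst '' {z : GaugeConfig 4 N SU3 × ℝ × ({p // wilsonBox x s p} → ℂ) |
      lo ≤ z.2.1 ∧ z.2.1 ≤ hi ∧ ‖z.2.2‖ = 1 ∧
        ∑ p, ‖(wilsonDirac (fundamentalRep (Fin 3)) z.1 z.2.1 1 *ᵥ
            fun q => if h : wilsonBox x s q then z.2.2 ⟨q, h⟩ else 0) p‖ ^ 2 ≤
          η ^ 2 * ∑ q, ‖z.2.2 q‖ ^ 2} =
      {U : GaugeConfig 4 N SU3 | ∃ μ' : ℝ, lo ≤ μ' ∧ μ' ≤ hi ∧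
        ∃ v : {p // wilsonBox x s p} → ℂ, v ≠ 0 ∧
          ∑ p, ‖(wilsonDirac (fundamentalRep (Fin 3)) U μ' 1 *ᵥ
              fun q => if h : wilsonBox x s q then v ⟨q, h⟩ else 0) p‖ ^ 2 ≤
            η ^ 2 * ∑ q, ‖v q‖ ^ 2} := by
  ext U
  constructor
  · rintro ⟨z, ⟨hlo, hhi, hn, hle⟩, rfl⟩
    refine ⟨z.2.1, hlo, hhi, z.2.2, ?_, hle⟩
    intro h0
    rw [h0, norm_zero] at hn
    exact zero_ne_one hn
  · rintro ⟨μ', hlo, hhi, v, hv0, hle⟩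
    have hvn : 0 < ‖v‖ := norm_pos_iff.2 hv0
    refine ⟨(U, μ', ‖v‖⁻¹ • v), ⟨hlo, hhi, ?_, ?_⟩, rfl⟩
    · show ‖‖v‖⁻¹ • v‖ = 1
      rw [norm_smul, norm_inv, norm_norm, inv_mul_cancel₀ hvn.ne']
    · show ∑ p, ‖(wilsonDirac (fundamentalRep (Fin 3)) U μ' 1 *ᵥ
          fun q => if h : wilsonBox x s q then (‖v‖⁻¹ • v) ⟨q, h⟩ else 0) p‖ ^ 2 ≤
        η ^ 2 * ∑ q, ‖(‖v‖⁻¹ • v) q‖ ^ 2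
      rw [mulVec_boxZeroExt_smul, sum_norm_sq_smul, sum_norm_sq_smul, mul_left_comm]
      exact mul_le_mul_of_nonneg_left hle (sq_nonneg _)

/-! ## The registered statements -/

/-- **The torus quasimode event is closed.**  For a box `(x, s)`, a bare-mass interval `[lo, hi]`
and a level `η`, the set of gauge fields `U` for which SOME bare mass `μ' ∈ [lo, hi]` and SOME
non-zero box vector `v` make the zero-extension `v̂` an `η`-quasimode of the torus Wilson–Dirac
operator, `‖D_W(U, μ', 1) v̂‖₂² ≤ η² ‖v‖₂²`, is closed in the configuration space: it is the
continuous image (first projection, `fst_image_torusQuasimodeLift`) of the compact lifted set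
(`isCompact_torusQuasimodeLift`), hence compact, hence closed (Hausdorff). -/
theorem isClosed_torusQuasimodeEvent {N : ℕ} [NeZero N] (x : TorusSite 4 N) (s : Fin 4 → ℕ)
    (lo hi η : ℝ) :
    IsClosed {U : GaugeConfig 4 N SU3 | ∃ μ' : ℝ, lo ≤ μ' ∧ μ' ≤ hi ∧
      ∃ v : {p // wilsonBox x s p} → ℂ, v ≠ 0 ∧
        ∑ p, ‖(wilsonDirac (fundamentalRep (Fin 3)) U μ' 1 *ᵥ
            fun q => if h : wilsonBox x s q then v ⟨q, h⟩ else 0) p‖ ^ 2 ≤ η ^ 2 * ∑ q, ‖v q‖ ^ 2} := by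
  rw [← fst_image_torusQuasimodeLift]
  exact ((isCompact_torusQuasimodeLift x s lo hi η).image continuous_fst).isClosed

/-- **The torus quasimode event is Borel measurable** (closed sets are measurable in the Borel
configuration space; corollary of `isClosed_torusQuasimodeEvent`). -/
theorem measurableSet_torusQuasimodeEvent {N : ℕ} [NeZero N] (x : TorusSite 4 N) (s : Fin 4 → ℕ)
    (lo hi η : ℝ) :
    MeasurableSet {U : GaugeConfig 4 N SU3 | ∃ μ' : ℝ, lo ≤ μ' ∧ μ' ≤ hi ∧
      ∃ v : {p // wilsonBox x s p} → ℂ, v ≠ 0 ∧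
        ∑ p, ‖(wilsonDirac (fundamentalRep (Fin 3)) U μ' 1 *ᵥ
            fun q => if h : wilsonBox x s q then v ⟨q, h⟩ else 0) p‖ ^ 2 ≤ η ^ 2 * ∑ q, ‖v q‖ ^ 2} :=
  (isClosed_torusQuasimodeEvent x s lo hi η).measurableSet

end Summit.QuantumFields.QCD.Cruxes.EarlyCrosserLaw.CellsInheritTorusExtinction

end
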